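import Mathlib.LinearAlgebra.Eigenspace.Minpoly
import Literature.NumberTheory.Automorphic.ZariskiGL
import Literature.NumberTheory.Automorphic.DiagonalizableGroups
import Literature.NumberTheory.Automorphic.RootDataProofs
import HarnessLib

/-!
# The Lie–Kolchin theorem for subgroups of `GL n` (Springer 6.3.1)

Trunk T-AUTOMORPHIC (G25 AutomorphicL); companion of `LinearAlgebraicGroups.lean` and
`ZariskiGL.lean` (namespace `Literature.Automorphic`, concrete `k`-points vocabulary: subgroups
`G ≤ GL n k`, `IsZConnected`, Zariski closures `zariskiClosure`). Main results, all proved: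

* `exists_common_eigenvector_of_isSolvable` — **Lie–Kolchin, eigenvector form**: over an
  algebraically closed field a Zariski-connected solvable `G ≤ GL n k` has a common eigenvector
  `v ≠ 0` in `kⁿ`;
* `exists_invariant_flag_standardRep` — **Lie–Kolchin, flag form** (Springer, *Linear Algebraic
  Groups*, 6.3.1: "*`x G x⁻¹ ⊆ 𝐓ₙ` for some `x`*", i.e. `G` stabilises a complete flag): there
  is a chain `0 = V₀ ⊆ V₁ ⊆ ⋯ ⊆ Vₙ = kⁿ` of `G`-stable subspaces with `dim Vᵢ = i`;
* the same for every *algebraic representation* (`IsAlgebraicRep`: matrix coefficients are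
  polynomial; Springer 2.3.2) of `G`: `exists_common_eigenvector_of_isAlgebraicRep`,
  `exists_invariant_submodule_succ`, `exists_invariant_flag`; the standard representation, its
  subrepresentations and quotients (Mathlib's `Representation.subrepresentation`,
  `Representation.quotient`) are algebraic (`isAlgebraicRep_standardRep`,
  `IsAlgebraicRep.subrepresentation`, `IsAlgebraicRep.quotient`), which is what makes the
  induction on the flag run.

This is the entrance to the structure theory of connected solvable groups (Springer §6.3), on
which the conjugacy theorems behind 8.1.1 (i) (`rootSubgroup_unique`, see
`RootSubgroupStructure.lean`) rest. The proof formalised is Kolchin's algebraic one (induction on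
the derived length), not Springer's (Borel's fixed point theorem 6.2.6 on the flag variety,
unavailable in this vocabulary): `exists_common_eigenvector_of_derivedSeries_eq_bot`.
Ingredients, all proved here or in the sibling files:

* `exists_common_eigenvector_of_commute` — commuting operators have a common eigenvector in any
  non-zero invariant subspace (induction on the dimension; Mathlib's
  `Module.End.exists_eigenvalue`);
* `IsZConnected.isZConnected_zariskiClosure_commutator` (`ZariskiGL.lean`, Springer 2.2.8:
  `cl (G, G)` is connected) and `map_subtype_derivedSeries_zariskiClosure_le` (the derived
  series of a closure, from `commutator_zariskiClosure_le`);
* `IsZConnected.eval_eq_eval_one_of_finite` — a regular function with finitely many values on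
  a connected group is constant (applied to `g ↦ χ(g⁻¹ d g)`, whose values are eigenvalues of
  `ρ(d)`: Mathlib's `Module.End.finite_hasEigenvalue`), giving the `G`-stability of the weight
  space `V_χ(D)` of `D = cl (G, G)`;
* determinants on the invariant subspace (Mathlib `LinearMap.det`, `LinearMap.det_smul`):
  commutators act with determinant `1` and by the scalar `χ`, so `χ ^ dim` is trivial on
  `(G, G)`, hence on its closure `D` (a closed condition, `isAlgebraicSubgroup_map_ker`), hence
  `χ|_D = 1` (`eq_one_of_isZConnected_of_pow_eq_one` of `RootDataProofs.lean`: a character of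
  finite order of a connected group is trivial, Springer 3.2.7 (iii)).

## Mathlib

Mathlib has Lie's theorem for solvable Lie algebras (`Mathlib.Algebra.Lie.LieTheorem`) but no
Lie–Kolchin theorem for groups and no algebraic groups; eigenspaces, `Module.End.HasEigenvalue`,
`Submodule`, quotients `V ⧸ U`, `LinearMap.restrict`, `LinearMap.det`, `derivedSeries`,
`IsSolvable`, and the sub/quotient representations `Representation.subrepresentation`,
`Representation.quotient` (a `ρ : G →* Module.End k V` *is* a `Representation k G V`) are
Mathlib's; no declaration below duplicates one (searched `Kolchin`, `common eigenvector`,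
`exists_forall_mem_eigenspace`, `triangularizable` + `solvable`). Inside Literature,
`Literature.NumberTheory.DiophantineGeometry.IsRationalRep` (`DiophantineGeometry/GLHighestWeight.lean`) is the sibling notion
for the *whole* group `GL σ k` (`[LinearOrder σ]`, entries-polynomial times `det ^ r`);
`IsAlgebraicRep` below is the version for arbitrary subgroups `G ≤ GL n k` in the `GLCoord`
vocabulary (`det⁻¹` is a coordinate) shared with `IsZConnected` and `IsAlgebraicChar`.

## References

* [SpringerLAG1998] T. A. Springer, *Linear Algebraic Groups*, 2nd ed., Progress in
  Mathematics 9, Birkhäuser (1998): 2.2.8, 2.3.2, 2.4.2, 3.2.7 (iii), 6.3.1 (Lie–Kolchin).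
* E. R. Kolchin, *Algebraic matric groups and the Picard–Vessiot theory of homogeneous linear
  ordinary differential equations*, Ann. of Math. (2) 49 (1948), 1–42 (the algebraic proof).
-/

open scoped MatrixGroups

namespace Literature.NumberTheory.Automorphic

open scoped Matrix

variable {k : Type*} [Field k] {n : Type*} [Fintype n] [DecidableEq n]

attribute [local instance] zariskiTopologyGL

/-! ### Regular functions with finitely many values on a connected group are constant -/

section FiniteValues

/-- A polynomial function on a Zariski-connected subgroup `H ≤ GL n k` taking only finitely many
values on `H` is constant on `H` (the fibres are closed and cover the irreducible `H`,
Springer 1.2.7/2.2.1). [folklore] -/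
theorem IsZConnected.eval_eq_eval_one_of_finite {H : Subgroup (GL n k)} (hH : IsZConnected H)
    (p : MvPolynomial (GLCoord n) k) {F : Set k} (hF : F.Finite)
    (hpF : ∀ h ∈ H, MvPolynomial.eval (glCoordFun h) p ∈ F) {h : GL n k} (hh : h ∈ H) :
    MvPolynomial.eval (glCoordFun h) p = MvPolynomial.eval (glCoordFun (1 : GL n k)) p := by
  classical
  let Z : k → Set (GL n k) := fun c => zeroLocusGL {p - MvPolynomial.C c}
  have hZ : ∀ (c : k) (g : GL n k), g ∈ Z c ↔ MvPolynomial.eval (glCoordFun g) p = c := by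
    intro c g
    simp [Z, zeroLocusGL, sub_eq_zero]
  obtain ⟨z, hz, hHz⟩ := isIrreducible_iff_sUnion_isClosed.1 hH.isIrreducible
    (hF.toFinset.image Z)
    (by
      intro z hz
      obtain ⟨c, -, rfl⟩ := Finset.mem_image.1 hz
      exact isClosed_zeroLocusGL _)
    (by
      intro g hg
      refine Set.mem_sUnion.2 ⟨Z (MvPolynomial.eval (glCoordFun g) p), ?_, (hZ _ g).2 rfl⟩
      exact Finset.mem_coe.2 (Finset.mem_image.2 ⟨_, hF.mem_toFinset.2 (hpF g hg), rfl⟩))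
  obtain ⟨c, -, rfl⟩ := Finset.mem_image.1 hz
  rw [(hZ c h).1 (hHz hh), (hZ c 1).1 (hHz H.one_mem)]

end FiniteValues

/-! ### A common eigenvector for commuting operators (the abelian case of Lie–Kolchin) -/

section Commuting

variable {V : Type*} [AddCommGroup V] [Module k V] [FiniteDimensional k V]

/-- **Commuting linear operators over an algebraically closed field have a common eigenvector** in
every non-zero subspace which they leave invariant and on which they commute (induction on the
dimension: either all operators are scalar on `W`, or an eigenspace in `W` of one of them is a
smaller invariant subspace). The abelian case of the Lie–Kolchin theorem (Springer 6.3.1;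
2.4.2 (ii) for semisimple operators). [folklore] -/
theorem exists_common_eigenvector_of_commute [IsAlgClosed k] (S : Set (Module.End k V))
    (W : Submodule k V) (hW : W ≠ ⊥) (hinv : ∀ f ∈ S, ∀ w ∈ W, f w ∈ W)
    (hcomm : ∀ f ∈ S, ∀ g ∈ S, ∀ w ∈ W, f (g w) = g (f w)) :
    ∃ v ∈ W, v ≠ 0 ∧ ∀ f ∈ S, ∃ c : k, f v = c • v := by
  -- strong induction on `finrank W`
  suffices key : ∀ (d : ℕ) (W : Submodule k V), Module.finrank k W = d → W ≠ ⊥ →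
      (∀ f ∈ S, ∀ w ∈ W, f w ∈ W) → (∀ f ∈ S, ∀ g ∈ S, ∀ w ∈ W, f (g w) = g (f w)) →
      ∃ v ∈ W, v ≠ 0 ∧ ∀ f ∈ S, ∃ c : k, f v = c • v from key _ W rfl hW hinv hcomm
  intro d
  induction d using Nat.strong_induction_on with
  | _ d ih =>
    intro W hWd hW hinv hcomm
    by_cases hscalar : ∀ f ∈ S, ∃ c : k, ∀ w ∈ W, f w = c • w
    · obtain ⟨v, hv, hv0⟩ := (Submodule.ne_bot_iff W).1 hW
      exact ⟨v, hv, hv0, fun f hf => (hscalar f hf).imp fun c hc => hc v hv⟩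
    · push Not at hscalar
      obtain ⟨f, hf, hfns⟩ := hscalar
      -- an eigenvalue `μ` of `f` on `W`
      let fW : Module.End k W := f.restrict (p := W) (q := W) fun w hw => hinv f hf w hw
      haveI : Nontrivial W := Submodule.nontrivial_iff_ne_bot.2 hW
      obtain ⟨μ, hμ⟩ := Module.End.exists_eigenvalue fW
      set W' : Submodule k V := W ⊓ f.eigenspace μ with hW'
      have hW'W : W' ≤ W := inf_le_left
      have hmemW' : ∀ w, w ∈ W' ↔ w ∈ W ∧ f w = μ • w := fun w => by
        rw [hW', Submodule.mem_inf, Module.End.mem_eigenspace_iff]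
      -- `W'` is non-zero ...
      have hW'ne : W' ≠ ⊥ := by
        obtain ⟨w, hw⟩ := hμ.exists_hasEigenvector
        rw [Submodule.ne_bot_iff]
        refine ⟨(w : V), (hmemW' w).2 ⟨w.2, ?_⟩, fun h0 => hw.2 (Subtype.ext h0)⟩
        have h := hw.apply_eq_smul
        simpa [fW, LinearMap.restrict_apply] using congrArg Subtype.val h
      -- ... and a proper subspace of `W`, since `f` is not scalar on `W`
      have hW'lt : W' < W := by
        refine lt_of_le_of_ne hW'W fun heq => ?_
        obtain ⟨w, hwW, hw⟩ := hfns μ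
        exact hw ((hmemW' w).1 (heq ▸ hwW)).2
      have hd' : Module.finrank k W' < d := hWd ▸ Submodule.finrank_lt_finrank_of_lt hW'lt
      -- `W'` is invariant (the operators commute with `f` on `W`)
      have hinv' : ∀ g ∈ S, ∀ w ∈ W', g w ∈ W' := by
        intro g hg w hw
        obtain ⟨hwW, hwμ⟩ := (hmemW' w).1 hw
        refine (hmemW' _).2 ⟨hinv g hg w hwW, ?_⟩
        rw [hcomm f hf g hg w hwW, hwμ, map_smul]
      obtain ⟨v, hvW', hv0, hv⟩ := ih _ hd' W' rfl hW'ne hinv'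
        (fun f hf g hg w hw => hcomm f hf g hg w (hW'W hw))
      exact ⟨v, hW'W hvW', hv0, hv⟩

end Commuting


/-! ### Algebraic (rational) representations of subgroups of `GL n k` -/

section AlgebraicRep

variable {V : Type*} [AddCommGroup V] [Module k V]

/-- A representation `ρ : G → End V` of a subgroup `G ≤ GL n k` on a `k`-space `V` is
*algebraic* (rational) if its matrix coefficients `g ↦ ℓ (ρ(g) v)` (`v ∈ V`, `ℓ ∈ V*`) are
polynomial functions of the coordinates of `g` (Springer 2.3.2 (3): a rational representation
is a homomorphism of algebraic groups `G → GL(V)`). The standard representation on `kⁿ`, its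
subrepresentations and quotients are algebraic (`isAlgebraicRep_standardRep`,
`IsAlgebraicRep.subrepresentation`, `IsAlgebraicRep.quotient`). [folklore] -/
def IsAlgebraicRep (G : Subgroup (GL n k)) (ρ : ↥G →* Module.End k V) : Prop :=
  ∀ (v : V) (ℓ : Module.Dual k V), ∃ p : MvPolynomial (GLCoord n) k,
    ∀ g : ↥G, ℓ (ρ g v) = MvPolynomial.eval (glCoordFun (g : GL n k)) p

/-- The standard representation of `GL n k` (and of its subgroups) on `kⁿ`. [folklore] -/
noncomputable def standardRep (G : Subgroup (GL n k)) : ↥G →* Module.End k (n → k) where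
  toFun g := Matrix.toLin' ((g : GL n k) : Matrix n n k)
  map_one' := by
    simp only [OneMemClass.coe_one, Units.val_one, Matrix.toLin'_one]
    rfl
  map_mul' g h := by simp [Matrix.toLin'_mul, Module.End.mul_eq_comp]

/-- `standardRep` acts by matrix multiplication. [folklore] -/
@[simp] lemma standardRep_apply (G : Subgroup (GL n k)) (g : ↥G) (v : n → k) :
    standardRep G g v = ((g : GL n k) : Matrix n n k) *ᵥ v :=
  Matrix.toLin'_apply _ _

/-- The standard representation is algebraic: `ℓ (g v) = ∑ᵢⱼ ℓ(eᵢ) gᵢⱼ vⱼ`. [folklore] -/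
theorem isAlgebraicRep_standardRep (G : Subgroup (GL n k)) :
    IsAlgebraicRep G (standardRep G) := by
  intro v ℓ
  refine ⟨∑ i, ∑ j, MvPolynomial.C (ℓ (Pi.single i 1) * v j) * MvPolynomial.X (Sum.inl (i, j)),
    fun g => ?_⟩
  rw [standardRep_apply, LinearMap.pi_apply_eq_sum_univ]
  simp only [map_sum, map_mul, MvPolynomial.eval_C, MvPolynomial.eval_X, glCoordFun_inl,
    Matrix.mulVec, dotProduct, smul_eq_mul, Finset.sum_mul]
  refine Finset.sum_congr rfl fun i _ => Finset.sum_congr rfl fun j _ => ?_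
  have e : (Pi.single i 1 : n → k) = fun j => if i = j then 1 else 0 := by
    funext j
    simp [Pi.single_apply, eq_comm]
  rw [e]
  ring

/-- The restriction of an algebraic representation to a subgroup is algebraic. [folklore] -/
theorem IsAlgebraicRep.comp_inclusion {G H : Subgroup (GL n k)} {ρ : ↥G →* Module.End k V}
    (hρ : IsAlgebraicRep G ρ) (hHG : H ≤ G) :
    IsAlgebraicRep H (ρ.comp (Subgroup.inclusion hHG)) :=
  fun v ℓ => (hρ v ℓ).imp fun _ hp h => hp (Subgroup.inclusion hHG h)

/-- A subrepresentation (Mathlib's `Representation.subrepresentation`) of an algebraic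
representation is algebraic (extend the functional from `W` to `V` along a complement).
[folklore] -/
theorem IsAlgebraicRep.subrepresentation {G : Subgroup (GL n k)} {ρ : ↥G →* Module.End k V}
    (hρ : IsAlgebraicRep G ρ) (W : Submodule k V) (hW : ∀ g : ↥G, W ≤ W.comap (ρ g)) :
    IsAlgebraicRep G (Representation.subrepresentation ρ W hW) := by
  intro w ℓ
  obtain ⟨π, hπ⟩ := W.subtype.exists_leftInverse_of_injective W.ker_subtype
  obtain ⟨p, hp⟩ := hρ (w : V) (ℓ.comp π)
  refine ⟨p, fun g => ?_⟩
  rw [← hp g, LinearMap.comp_apply, Representation.subrepresentation_apply,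
    ← LinearMap.coe_restrict_apply (hW g) w]
  exact congrArg ℓ (LinearMap.congr_fun hπ _).symm

/-- A quotient (Mathlib's `Representation.quotient`) of an algebraic representation is
algebraic. [folklore] -/
theorem IsAlgebraicRep.quotient {G : Subgroup (GL n k)} {ρ : ↥G →* Module.End k V}
    (hρ : IsAlgebraicRep G ρ) (U : Submodule k V) (hU : ∀ g : ↥G, U ≤ U.comap (ρ g)) :
    IsAlgebraicRep G (Representation.quotient ρ U hU) := by
  intro q ℓ
  induction q using Submodule.Quotient.induction_on with
  | _ v =>
    obtain ⟨p, hp⟩ := hρ v (ℓ.comp U.mkQ)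
    exact ⟨p, fun g => by
      rw [Representation.quotient_apply, Submodule.mapQ_apply]
      exact hp g⟩

end AlgebraicRep

/-! ### The Lie–Kolchin theorem: a connected solvable group has a common eigenvector -/

section LieKolchin

/-- The derived series of a subgroup `H ≤ GL n k`, as subgroups of `GL n k`. [folklore] -/
lemma map_subtype_derivedSeries_succ (H : Subgroup (GL n k)) (m : ℕ) :
    (derivedSeries ↥H (m + 1)).map H.subtype =
      ⁅(derivedSeries ↥H m).map H.subtype, (derivedSeries ↥H m).map H.subtype⁆ := by
  rw [derivedSeries_succ, Subgroup.map_commutator]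

/-- The derived series of the commutator subgroup is the shifted derived series:
`D^m((H, H)) = D^{m+1}(H)` (as subgroups of `GL n k`). [folklore] -/
lemma map_subtype_derivedSeries_commutator (H : Subgroup (GL n k)) (m : ℕ) :
    (derivedSeries ↥(⁅H, H⁆ : Subgroup (GL n k)) m).map (⁅H, H⁆ : Subgroup (GL n k)).subtype =
      (derivedSeries ↥H (m + 1)).map H.subtype := by
  induction m with
  | zero =>
    rw [map_subtype_derivedSeries_succ]
    simp only [derivedSeries_zero, ← MonoidHom.range_eq_map, Subgroup.range_subtype]
  | succ m ih =>
    rw [map_subtype_derivedSeries_succ, ih, ← map_subtype_derivedSeries_succ H (m + 1)]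

/-- The derived series of the Zariski closure is controlled by that of the subgroup:
`D^m(cl A) ⊆ cl D^m(A)` (from `commutator_zariskiClosure_le`). [folklore] -/
lemma map_subtype_derivedSeries_zariskiClosure_le (A : Subgroup (GL n k)) (m : ℕ) :
    (derivedSeries ↥(zariskiClosure A) m).map (zariskiClosure A).subtype ≤
      zariskiClosure ((derivedSeries ↥A m).map A.subtype) := by
  induction m with
  | zero =>
    simp only [derivedSeries_zero, ← MonoidHom.range_eq_map, Subgroup.range_subtype]
    exact le_rfl
  | succ m ih =>
    rw [map_subtype_derivedSeries_succ, map_subtype_derivedSeries_succ]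
    exact (Subgroup.commutator_mono ih ih).trans (commutator_zariskiClosure_le _ _)

variable {V : Type*} [AddCommGroup V] [Module k V] [FiniteDimensional k V]

omit [FiniteDimensional k V] in
/-- The eigenvalue of an operator of a representation on a common eigenvector defines a
character. [folklore] -/
lemma exists_character_of_common_eigenvector {G : Subgroup (GL n k)} (ρ : ↥G →* Module.End k V)
    {v : V} (hv : v ≠ 0) (h : ∀ g : ↥G, ∃ c : k, ρ g v = c • v) :
    ∃ χ : ↥G →* kˣ, ∀ g : ↥G, ρ g v = ((χ g : kˣ) : k) • v := by
  choose c hc using h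
  have hc1 : c 1 = 1 := by
    have h1 := hc 1
    rw [map_one, Module.End.one_apply] at h1
    exact smul_left_injective k hv (h1.symm.trans (one_smul k v).symm)
  have hcmul : ∀ g h, c (g * h) = c g * c h := by
    intro g h
    have e := hc (g * h)
    rw [map_mul, Module.End.mul_apply, hc h, map_smul, hc g, smul_smul] at e
    exact ((smul_left_injective k hv e).symm).trans (mul_comm _ _)
  have hc0 : ∀ g, c g ≠ 0 := by
    intro g h0
    have e := hcmul g⁻¹ g
    rw [inv_mul_cancel, hc1, h0, mul_zero] at e
    exact one_ne_zero e
  let χ : ↥G →* kˣ :=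
    { toFun := fun g => Units.mk0 (c g) (hc0 g)
      map_one' := Units.ext hc1
      map_mul' := fun g h => Units.ext (hcmul g h) }
  exact ⟨χ, fun g => hc g⟩

/-- **Lie–Kolchin, inductive form, for algebraic representations.** Over an algebraically closed
field, if `G ≤ GL n k` is Zariski-connected with `m`-th derived group trivial and `ρ` is an
algebraic representation of `G` on `V ≠ 0`, then `G` has a common eigenvector in `V`. Induction
on `m` (Springer 6.3.1; the argument is Kolchin's, avoiding the fixed point theorem):
`D = cl (G, G) ⊆ G` is connected (2.2.8) with `D^{m-1} = e`, so has a common eigenvector `v₀`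
with character `χ`; the weight space `W = V_χ(D)` is `G`-stable because `g ↦ χ(g⁻¹ d g)` takes
finitely many values (eigenvalues of `ρ(d)`) on the connected `G`, hence is constant; on `W`,
commutators act with determinant `1` and by the scalar `χ`, so `χ^{dim W}` kills `(G, G)`,
hence `D` (a closed condition), hence `χ|_D = 1` (`D` connected, 3.2.7 (iii)); thus `G` acts on
`W` through commuting operators, which have a common eigenvector. [cite: SpringerLAG1998, 6.3.1] -/
theorem exists_common_eigenvector_of_derivedSeries_eq_bot [IsAlgClosed k] [Nontrivial V] :
    ∀ (m : ℕ) (G : Subgroup (GL n k)) (ρ : ↥G →* Module.End k V), IsZConnected G →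
      derivedSeries ↥G m = ⊥ → IsAlgebraicRep G ρ →
      ∃ v : V, v ≠ 0 ∧ ∀ g : ↥G, ∃ c : k, ρ g v = c • v := by
  intro m
  induction m with
  | zero =>
    intro G ρ hG hbot _
    obtain ⟨v, hv⟩ := exists_ne (0 : V)
    refine ⟨v, hv, fun g => ⟨1, ?_⟩⟩
    have hg1 : g ∈ derivedSeries ↥G 0 := by
      rw [derivedSeries_zero]; exact Subgroup.mem_top _
    rw [hbot, Subgroup.mem_bot] at hg1
    rw [hg1, map_one, one_smul]
    rfl
  | succ m ih =>
    intro G ρ hG hbot hρ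
    classical
    -- the closure `D ⊆ G` of the commutator subgroup
    set D₀ : Subgroup (GL n k) := ⁅G, G⁆ with hD₀
    set D : Subgroup (GL n k) := zariskiClosure D₀ with hD
    have hDconn : IsZConnected D := hG.isZConnected_zariskiClosure_commutator G
    have hD₀D : D₀ ≤ D := le_zariskiClosure D₀
    have hD₀G : D₀ ≤ G := Subgroup.commutator_le.2 fun g hg h hh =>
      G.mul_mem (G.mul_mem (G.mul_mem hg hh) (G.inv_mem hg)) (G.inv_mem hh)
    have hDG : D ≤ G := zariskiClosure_le hG.1 hD₀G
    have hDbot : derivedSeries ↥D m = ⊥ := by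
      have h := map_subtype_derivedSeries_zariskiClosure_le D₀ m
      rw [hD₀, map_subtype_derivedSeries_commutator, hbot, Subgroup.map_bot, zariskiClosure_bot,
        le_bot_iff, Subgroup.map_eq_bot_iff_of_injective _ (Subgroup.subtype_injective _)] at h
      exact h
    -- a common eigenvector `v₀` of `D`, with character `χ`
    set ρD : ↥D →* Module.End k V := ρ.comp (Subgroup.inclusion hDG) with hρD
    have hρDapp : ∀ (d : GL n k) (hd : d ∈ D), ρD ⟨d, hd⟩ = ρ ⟨d, hDG hd⟩ := fun d hd => rfl
    obtain ⟨v₀, hv₀, hDv₀⟩ := ih D ρD hDconn hDbot (hρ.comp_inclusion hDG)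
    obtain ⟨χ, hχ⟩ := exists_character_of_common_eigenvector ρD hv₀ hDv₀
    -- the weight space `W` of `χ`
    set W : Submodule k V :=
      ⨅ d : ↥D, Module.End.eigenspace (ρD d) ((χ d : kˣ) : k) with hWdef
    have hmemW : ∀ v, v ∈ W ↔ ∀ d : ↥D, ρD d v = ((χ d : kˣ) : k) • v := fun v => by
      simp only [hWdef, Submodule.mem_iInf, Module.End.mem_eigenspace_iff]
    have hv₀W : v₀ ∈ W := (hmemW v₀).2 hχ
    have hWne : W ≠ ⊥ := fun h => hv₀ ((Submodule.eq_bot_iff W).1 h v₀ hv₀W)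
    -- `D` is normal in `G`
    have hGD₀ : ∀ g ∈ G, D₀.map (MulAut.conj g : GL n k →* GL n k) = D₀ := by
      intro g hg
      have hGg : G.map (MulAut.conj g : GL n k →* GL n k) = G :=
        Subgroup.mem_normalizer_iff_map_conj_eq.1 (Subgroup.le_normalizer hg)
      rw [hD₀, Subgroup.map_commutator, hGg]
    have hGD : ∀ g ∈ G, ∀ d ∈ D, g⁻¹ * d * g ∈ D := by
      intro g hg d hd
      have h := map_conj_zariskiClosure_eq (hGD₀ g⁻¹ (G.inv_mem hg))
      rw [← hD] at h
      have : g⁻¹ * d * g⁻¹⁻¹ ∈ D.map (MulAut.conj g⁻¹ : GL n k →* GL n k) := ⟨d, hd, rfl⟩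
      rw [h, inv_inv] at this
      exact this
    -- `χ` is an algebraic character
    obtain ⟨ℓ, hℓ⟩ := Module.Projective.exists_dual_eq_one k hv₀
    have hχℓ : ∀ d : ↥D, ((χ d : kˣ) : k) = ℓ (ρD d v₀) := fun d => by
      rw [hχ d, map_smul, hℓ, smul_eq_mul, mul_one]
    obtain ⟨pχ, hpχ⟩ := (hρ.comp_inclusion hDG) v₀ ℓ
    have hχalg : IsAlgebraicChar χ := ⟨pχ, fun d => by
      rw [hχℓ, hρD]
      exact hpχ d⟩
    -- the character `χ` is `G`-invariant: `χ (g⁻¹ d g) = χ d`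
    have hχG : ∀ g (hg : g ∈ G) d (hd : d ∈ D),
        ((χ ⟨g⁻¹ * d * g, hGD g hg d hd⟩ : kˣ) : k) = ((χ ⟨d, hd⟩ : kˣ) : k) := by
      intro g hg d hd
      -- the regular function `F(x) = χ (x⁻¹ d x) = ℓ (ρ(x⁻¹ d x) v₀)` on `G`
      obtain ⟨P, hP⟩ : IsPolyMapGL fun x : GL n k => x⁻¹ * d * x :=
        (isPolyMapGL_id.inv.mul (isPolyMapGL_const d)).mul isPolyMapGL_id
      set p : MvPolynomial (GLCoord n) k := MvPolynomial.bind₁ P pχ with hp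
      have hpG : ∀ x (hx : x ∈ G), MvPolynomial.eval (glCoordFun x) p =
          ((χ ⟨x⁻¹ * d * x, hGD x hx d hd⟩ : kˣ) : k) := by
        intro x hx
        rw [hp, eval_bind₁, hχℓ, hρD, hpχ]
        exact congrArg (fun f => MvPolynomial.eval f pχ) (funext fun c => (hP x c).symm)
      -- its values are eigenvalues of `ρ d`: eigenvector `ρ(x) v₀`
      set F : Set k := {μ | Module.End.HasEigenvalue (ρ ⟨d, hDG hd⟩) μ} with hF
      have hfin : F.Finite := Module.End.finite_hasEigenvalue _
      have hpF : ∀ x ∈ G, MvPolynomial.eval (glCoordFun x) p ∈ F := by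
        intro x hx
        rw [hpG x hx, hF, Set.mem_setOf_eq]
        have hdx := hGD x hx d hd
        refine Module.End.hasEigenvalue_of_hasEigenvector (x := ρ ⟨x, hx⟩ v₀) ⟨?_, ?_⟩
        · rw [Module.End.mem_eigenspace_iff]
          have e : ρ ⟨d, hDG hd⟩ (ρ ⟨x, hx⟩ v₀) = ρ ⟨x, hx⟩ (ρD ⟨x⁻¹ * d * x, hdx⟩ v₀) := by
            rw [hρDapp, ← Module.End.mul_apply, ← map_mul, ← Module.End.mul_apply, ← map_mul]
            congr 2
            apply Subtype.ext
            simp [mul_assoc]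
          rw [e, hχ, map_smul]
        · intro h0
          apply hv₀
          have := congrArg (ρ ⟨x, hx⟩⁻¹) h0
          rwa [map_zero, ← Module.End.mul_apply, ← map_mul, inv_mul_cancel, map_one,
            Module.End.one_apply] at this
      have h := hG.eval_eq_eval_one_of_finite p hfin hpF hg
      rw [hpG g hg, hpG 1 G.one_mem] at h
      rw [h]
      have e1 : (⟨1⁻¹ * d * 1, hGD 1 G.one_mem d hd⟩ : ↥D) = ⟨d, hd⟩ := Subtype.ext (by simp)
      rw [e1]
    -- `W` is `G`-stable
    have hWG : ∀ (g : ↥G), ∀ v ∈ W, ρ g v ∈ W := by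
      intro g v hv
      rw [hmemW] at hv ⊢
      intro d
      have hd' := hGD g g.2 d d.2
      have e : ρD d (ρ g v) = ρ g (ρD ⟨_, hd'⟩ v) := by
        rw [hρDapp _ hd', show ρD d = ρ ⟨(d : GL n k), hDG d.2⟩ from rfl, ← Module.End.mul_apply,
          ← map_mul, ← Module.End.mul_apply, ← map_mul]
        congr 2
        apply Subtype.ext
        simp [mul_assoc]
      rw [e, hv ⟨_, hd'⟩, map_smul, hχG g g.2 d d.2]
    -- the subrepresentation on `W`; commutators have determinant one and act by `χ`
    set ρW := Representation.subrepresentation ρ W hWG with hρW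
    have hdet : ∀ g h : ↥G, LinearMap.det (ρW (g * h * g⁻¹ * h⁻¹)) = 1 := by
      intro g h
      have e : LinearMap.det (ρW (g * h * g⁻¹ * h⁻¹)) =
          (LinearMap.det (ρW g) * LinearMap.det (ρW g⁻¹)) *
            (LinearMap.det (ρW h) * LinearMap.det (ρW h⁻¹)) := by
        simp only [map_mul]
        ring
      have hx : ∀ x : ↥G, LinearMap.det (ρW x) * LinearMap.det (ρW x⁻¹) = 1 := fun x => by
        rw [← map_mul, ← map_mul, mul_inv_cancel, map_one, map_one]
      rw [e, hx g, hx h, one_mul]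
    have hscal : ∀ (x : ↥G) (hxD : (x : GL n k) ∈ D),
        ρW x = ((χ ⟨x, hxD⟩ : kˣ) : k) • LinearMap.id := by
      intro x hxD
      apply LinearMap.ext
      intro w
      apply Subtype.ext
      rw [hρW, Representation.subrepresentation_apply, LinearMap.coe_restrict_apply]
      have hw := (hmemW w).1 w.2 ⟨x, hxD⟩
      rw [hρDapp] at hw
      simpa using hw
    set N : ℕ := Module.finrank k W with hNdef
    have hN : N ≠ 0 := fun h0 => hWne (Submodule.finrank_eq_zero.1 h0)
    have hpow : ∀ (g h : ↥G) (hc : ((g * h * g⁻¹ * h⁻¹ : ↥G) : GL n k) ∈ D),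
        ((χ ⟨_, hc⟩ : kˣ) : k) ^ N = 1 := by
      intro g h hc
      have h1 := hdet g h
      rw [hscal _ hc, LinearMap.det_smul, LinearMap.det_id, mul_one] at h1
      exact h1
    have hcommD : ∀ g (hg : g ∈ G) h (hh : h ∈ G),
        ((⟨g, hg⟩ * ⟨h, hh⟩ * ⟨g, hg⟩⁻¹ * ⟨h, hh⟩⁻¹ : ↥G) : GL n k) ∈ D := by
      intro g hg h hh
      refine hD₀D ?_
      have hc := Subgroup.commutator_mem_commutator (H₁ := G) (H₂ := G) hg hh
      rw [commutatorElement_def] at hc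
      simpa only [Subgroup.coe_mul, Subgroup.coe_inv] using hc
    -- so `χ ^ N` kills `(G, G)`, hence `D`; and then `χ = 1`
    have hχNalg : IsAlgebraicChar (χ ^ N) := (characterLattice D).pow_mem hχalg N
    have hKalg : IsAlgebraicSubgroup ((χ ^ N).ker.map D.subtype) :=
      isAlgebraicSubgroup_map_ker hDconn.1 hχNalg
    have hD₀K : D₀ ≤ (χ ^ N).ker.map D.subtype := by
      rw [hD₀, Subgroup.commutator_le]
      intro g hg h hh
      refine ⟨⟨_, hcommD g hg h hh⟩, ?_, ?_⟩
      · rw [SetLike.mem_coe, MonoidHom.mem_ker, MonoidHom.pow_apply]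
        apply Units.ext
        rw [Units.val_pow_eq_pow_val, Units.val_one]
        exact hpow _ _ (hcommD g hg h hh)
      · rw [commutatorElement_def]
        simp only [Subgroup.coe_subtype, Subgroup.coe_mul, Subgroup.coe_inv]
    have hDK : D ≤ (χ ^ N).ker.map D.subtype := zariskiClosure_le hKalg hD₀K
    have hχN : χ ^ N = 1 := by
      apply MonoidHom.ext
      intro d
      obtain ⟨d', hd', hdd'⟩ := hDK d.2
      have : d' = d := Subtype.ext hdd'
      subst this
      exact hd'
    have hχ1 : χ = 1 := eq_one_of_isZConnected_of_pow_eq_one hDconn hχalg hN hχN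
    -- hence `D` acts trivially on `W` and `G` acts on `W` through commuting operators
    have hDtriv : ∀ d (hd : d ∈ D), ∀ v ∈ W, ρ ⟨d, hDG hd⟩ v = v := by
      intro d hd v hv
      have h := (hmemW v).1 hv ⟨d, hd⟩
      rw [hρDapp, hχ1, MonoidHom.one_apply, Units.val_one, one_smul] at h
      exact h
    have hcommW : ∀ g h : ↥G, ∀ v ∈ W, ρ g (ρ h v) = ρ h (ρ g v) := by
      intro g h v hv
      have hcD : ((g⁻¹ * h⁻¹ * g * h : ↥G) : GL n k) ∈ D := by
        have hc := hcommD _ (G.inv_mem g.2) _ (G.inv_mem h.2)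
        simpa only [Subgroup.coe_mul, Subgroup.coe_inv, inv_inv] using hc
      have htriv : ρ (g⁻¹ * h⁻¹ * g * h) v = v := by
        have h1 := hDtriv _ hcD v hv
        simpa only [Subtype.coe_eta] using h1
      have e : g * h = h * g * (g⁻¹ * h⁻¹ * g * h) := by group
      calc ρ g (ρ h v) = ρ (g * h) v := by rw [map_mul, Module.End.mul_apply]
        _ = ρ (h * g * (g⁻¹ * h⁻¹ * g * h)) v := by rw [← e]
        _ = ρ (h * g) (ρ (g⁻¹ * h⁻¹ * g * h) v) := by rw [map_mul ρ (h * g), Module.End.mul_apply]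
        _ = ρ (h * g) v := by rw [htriv]
        _ = ρ h (ρ g v) := by rw [map_mul, Module.End.mul_apply]
    -- a common eigenvector of the commuting operators `ρ(g)|_W`
    obtain ⟨v, -, hv0, hv⟩ := exists_common_eigenvector_of_commute
      (Set.range fun g : ↥G => (ρ g : Module.End k V)) W hWne
      (by
        rintro _ ⟨g, rfl⟩ w hw
        exact hWG g w hw)
      (by
        rintro _ ⟨g, rfl⟩ _ ⟨h, rfl⟩ w hw
        exact hcommW g h w hw)
    exact ⟨v, hv0, fun g => hv _ ⟨g, rfl⟩⟩

/-- **Lie–Kolchin theorem for algebraic representations** (Springer 6.3.1 in the form "a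
connected solvable group fixes a line in every rational representation"; Kolchin): over an
algebraically closed field, a Zariski-connected solvable `G ≤ GL n k` has a common eigenvector in
every non-zero algebraic representation. [cite: SpringerLAG1998, 6.3.1] -/
theorem exists_common_eigenvector_of_isAlgebraicRep [IsAlgClosed k] [Nontrivial V]
    {G : Subgroup (GL n k)} (hG : IsZConnected G) (hsolv : IsSolvable ↥G)
    {ρ : ↥G →* Module.End k V} (hρ : IsAlgebraicRep G ρ) :
    ∃ v : V, v ≠ 0 ∧ ∀ g : ↥G, ∃ c : k, ρ g v = c • v := by
  obtain ⟨m, hm⟩ := hsolv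
  exact exists_common_eigenvector_of_derivedSeries_eq_bot m G ρ hG hm hρ

/-- **Lie–Kolchin, flag form, inductive step**: in an algebraic representation of a connected
solvable group, every proper invariant subspace `U` lies in an invariant subspace of dimension
`dim U + 1` (apply the eigenvector form to the quotient representation `V/U`).
[cite: SpringerLAG1998, 6.3.1] -/
theorem exists_invariant_submodule_succ [IsAlgClosed k] {G : Subgroup (GL n k)}
    (hG : IsZConnected G) (hsolv : IsSolvable ↥G) {ρ : ↥G →* Module.End k V}
    (hρ : IsAlgebraicRep G ρ) (U : Submodule k V) (hU : ∀ (g : ↥G), ∀ u ∈ U, ρ g u ∈ U)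
    (hUtop : U ≠ ⊤) :
    ∃ U' : Submodule k V, U < U' ∧ (∀ (g : ↥G), ∀ u ∈ U', ρ g u ∈ U') ∧
      Module.finrank k U' = Module.finrank k U + 1 := by
  haveI : Nontrivial (V ⧸ U) := Submodule.Quotient.nontrivial_iff.2 hUtop
  obtain ⟨q, hq0, hq⟩ :=
    exists_common_eigenvector_of_isAlgebraicRep hG hsolv (hρ.quotient U hU)
  obtain ⟨v, rfl⟩ := Submodule.Quotient.mk_surjective U q
  set U' : Submodule k V := (k ∙ Submodule.Quotient.mk (p := U) v).comap U.mkQ with hU'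
  have hmemU' : ∀ x, x ∈ U' ↔
      Submodule.Quotient.mk (p := U) x ∈ k ∙ Submodule.Quotient.mk (p := U) v := fun x => Iff.rfl
  have hUU' : U ≤ U' := by
    intro u hu
    rw [hmemU', (Submodule.Quotient.mk_eq_zero U).2 hu]
    exact Submodule.zero_mem _
  have hvU' : v ∈ U' := (hmemU' v).2 (Submodule.mem_span_singleton_self _)
  have hvU : v ∉ U := fun h => hq0 ((Submodule.Quotient.mk_eq_zero U).2 h)
  refine ⟨U', lt_of_le_of_ne hUU' (fun h => hvU (h ▸ hvU')), ?_, ?_⟩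
  · intro g u hu
    rw [hmemU'] at hu ⊢
    obtain ⟨a, ha⟩ := Submodule.mem_span_singleton.1 hu
    obtain ⟨c, hc⟩ := hq g
    rw [show Submodule.Quotient.mk (p := U) (ρ g u) =
        Representation.quotient ρ U hU g (Submodule.Quotient.mk u) by
      rw [Representation.quotient_apply, Submodule.mapQ_apply], ← ha, map_smul, hc, smul_smul]
    exact Submodule.smul_mem _ _ (Submodule.mem_span_singleton_self _)
  · -- `dim U' = dim (U'/U) + dim U = 1 + dim U`
    set f : U' →ₗ[k] V ⧸ U := U.mkQ.domRestrict U' with hf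
    have hker : Module.finrank k (LinearMap.ker f) = Module.finrank k U := by
      rw [hf, LinearMap.ker_domRestrict, Submodule.ker_mkQ]
      exact (Submodule.comapSubtypeEquivOfLe hUU').finrank_eq
    have hrange : Module.finrank k (LinearMap.range f) = 1 := by
      rw [hf, LinearMap.range_domRestrict, hU', Submodule.map_comap_eq_of_surjective
        (Submodule.mkQ_surjective U)]
      exact finrank_span_singleton hq0
    have h := LinearMap.finrank_range_add_finrank_ker f
    rw [hker, hrange] at h
    omega

/-- **Lie–Kolchin, flag form** (Springer 6.3.1: "*there is `x` with `x G x⁻¹ ⊆ 𝐓ₙ`*", i.e.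
`G` stabilises a complete flag): in an algebraic representation `V` of a Zariski-connected
solvable `G ≤ GL n k` over an algebraically closed field there is a chain
`0 = V₀ ⊆ V₁ ⊆ ⋯` of `G`-stable subspaces with `dim Vᵢ = i` for `i ≤ dim V`.
[cite: SpringerLAG1998, 6.3.1] -/
theorem exists_invariant_flag [IsAlgClosed k] {G : Subgroup (GL n k)} (hG : IsZConnected G)
    (hsolv : IsSolvable ↥G) {ρ : ↥G →* Module.End k V} (hρ : IsAlgebraicRep G ρ) :
    ∃ F : ℕ → Submodule k V, F 0 = ⊥ ∧ Monotone F ∧ (∀ i (g : ↥G), ∀ v ∈ F i, ρ g v ∈ F i) ∧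
      ∀ i ≤ Module.finrank k V, Module.finrank k (F i) = i := by
  classical
  -- the successor of an invariant subspace
  let S : {U : Submodule k V // ∀ (g : ↥G), ∀ u ∈ U, ρ g u ∈ U} →
      {U : Submodule k V // ∀ (g : ↥G), ∀ u ∈ U, ρ g u ∈ U} := fun U =>
    if h : U.1 = ⊤ then U
    else ⟨(exists_invariant_submodule_succ hG hsolv hρ U.1 U.2 h).choose,
      (exists_invariant_submodule_succ hG hsolv hρ U.1 U.2 h).choose_spec.2.1⟩
  have hSle : ∀ U, U.1 ≤ (S U).1 := by
    intro U
    by_cases h : U.1 = ⊤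
    · rw [show S U = U from dif_pos h]
    · rw [show S U = ⟨_, (exists_invariant_submodule_succ hG hsolv hρ U.1 U.2 h).choose_spec.2.1⟩
        from dif_neg h]
      exact (exists_invariant_submodule_succ hG hsolv hρ U.1 U.2 h).choose_spec.1.le
  have hSrank : ∀ U, U.1 ≠ ⊤ → Module.finrank k (S U).1 = Module.finrank k U.1 + 1 := by
    intro U h
    rw [show S U = ⟨_, (exists_invariant_submodule_succ hG hsolv hρ U.1 U.2 h).choose_spec.2.1⟩
      from dif_neg h]
    exact (exists_invariant_submodule_succ hG hsolv hρ U.1 U.2 h).choose_spec.2.2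
  let F : ℕ → {U : Submodule k V // ∀ (g : ↥G), ∀ u ∈ U, ρ g u ∈ U} :=
    fun i => S^[i] ⟨⊥, fun g u hu => by rw [(Submodule.mem_bot k).1 hu, map_zero]; exact zero_mem _⟩
  have hF : ∀ i, F (i + 1) = S (F i) := fun i => Function.iterate_succ_apply' S i _
  refine ⟨fun i => (F i).1, rfl, ?_, fun i g v hv => (F i).2 g v hv, ?_⟩
  · refine monotone_nat_of_le_succ fun i => ?_
    show (F i).1 ≤ (F (i + 1)).1
    rw [hF]
    exact hSle (F i)
  · intro i hi
    induction i with
    | zero => exact finrank_bot k V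
    | succ i ih =>
      have hi' : i ≤ Module.finrank k V := Nat.le_of_succ_le hi
      have h1 : Module.finrank k (F i).1 = i := ih hi'
      have hne : (F i).1 ≠ ⊤ := by
        intro htop
        rw [htop, finrank_top] at h1
        omega
      show Module.finrank k (F (i + 1)).1 = i + 1
      rw [hF, hSrank (F i) hne, h1]

end LieKolchin

/-! ### The standard representation: Lie–Kolchin for subgroups of `GL n k` -/

section Standard

/-- **Lie–Kolchin theorem (common eigenvector form; Springer 6.3.1, Kolchin).** Over an
algebraically closed field, a Zariski-connected solvable subgroup `G ≤ GL n k` (`n` non-empty)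
has a common eigenvector: there is `v ≠ 0` in `kⁿ` with `g v ∈ k v` for all `g ∈ G`.
[cite: SpringerLAG1998, 6.3.1] -/
theorem exists_common_eigenvector_of_isSolvable [IsAlgClosed k] [Nonempty n]
    {G : Subgroup (GL n k)} (hG : IsZConnected G) (hsolv : IsSolvable ↥G) :
    ∃ v : n → k, v ≠ 0 ∧ ∀ g ∈ G, ∃ c : k, ((g : GL n k) : Matrix n n k) *ᵥ v = c • v := by
  obtain ⟨v, hv, h⟩ := exists_common_eigenvector_of_isAlgebraicRep hG hsolv
    (isAlgebraicRep_standardRep G)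
  exact ⟨v, hv, fun g hg => by simpa only [standardRep_apply] using h ⟨g, hg⟩⟩

/-- **Lie–Kolchin for a solvable subgroup with connected closure**: the closure is solvable
(`isSolvable_zariskiClosure`) and connected, and a common eigenvector for it is one for `G`.
[cite: SpringerLAG1998, 6.3.1] -/
theorem exists_common_eigenvector_of_isSolvable_of_isZConnected_zariskiClosure [IsAlgClosed k]
    [Nonempty n] {G : Subgroup (GL n k)} (hG : IsZConnected (zariskiClosure G))
    (hsolv : IsSolvable ↥G) :
    ∃ v : n → k, v ≠ 0 ∧ ∀ g ∈ G, ∃ c : k, ((g : GL n k) : Matrix n n k) *ᵥ v = c • v := by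
  obtain ⟨v, hv, h⟩ :=
    exists_common_eigenvector_of_isSolvable hG (isSolvable_zariskiClosure hsolv)
  exact ⟨v, hv, fun g hg => h g (le_zariskiClosure G hg)⟩

/-- **Lie–Kolchin, flag form, for `G ≤ GL n k`** (Springer 6.3.1): a Zariski-connected
solvable `G ≤ GL n k` over an algebraically closed field stabilises a complete flag of `kⁿ`.
[cite: SpringerLAG1998, 6.3.1] -/
theorem exists_invariant_flag_standardRep [IsAlgClosed k] {G : Subgroup (GL n k)}
    (hG : IsZConnected G) (hsolv : IsSolvable ↥G) :
    ∃ F : ℕ → Submodule k (n → k), F 0 = ⊥ ∧ Monotone F ∧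
      (∀ i, ∀ g ∈ G, ∀ v ∈ F i, ((g : GL n k) : Matrix n n k) *ᵥ v ∈ F i) ∧
      ∀ i ≤ Fintype.card n, Module.finrank k (F i) = i := by
  obtain ⟨F, h0, hmono, hinv, hrank⟩ :=
    exists_invariant_flag hG hsolv (isAlgebraicRep_standardRep G)
  refine ⟨F, h0, hmono, fun i g hg v hv => ?_, fun i hi => hrank i ?_⟩
  · simpa only [standardRep_apply] using hinv i ⟨g, hg⟩ v hv
  · simpa using hi

end Standard

end Literature.NumberTheory.Automorphic
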